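import Mathlib
import Summits.ValiantsHypothesis.ValiantsHypothesis.Theorems.NewtonUnitEquationsDissociatedUniformTotalsLaw
import Summits.ValiantsHypothesis.ValiantsHypothesis.Theorems.NewtonUnitEquationsDissociatedUniformTotalsLawUnimodal
import Summits.ValiantsHypothesis.ValiantsHypothesis.Theorems.NewtonUnitEquationsDissociatedUniformTotalsLawUnionConverse
import Summits.ValiantsHypothesis.ValiantsHypothesis.Theorems.NewtonUnitEquationsDissociatedUniformTotalsLawHexagon
import Summits.ValiantsHypothesis.ValiantsHypothesis.Theorems.NewtonUnitEquationsDissociatedUniformTotalsLawHexagonCount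
import Literature.Computability.AlgebraicComplexity.NewtonPolygonTauProductBounds
import HarnessLib

/-!
# Crux `NewtonUnitEquations.DissociatedUniform` (stmt-ValiantsHypothesis-5905), `n = 3` totals law of model (Q**):
# the PAIRWISE-TOP (TRIANGLE) RELAXATION `T ≤ N_△ ≤ #mixed hexagons`, and the located class-free conjecture `TriangleBound`

A class-hull vertex `a x + b y + c z` of class `s = x + y + z`, exposed by the weight `w`, is in particular a strict `w`-top of each of
the three PAIR FIBRES through it: `a x + b y` tops `P_{x+y} = {a x' + b(x+y−x')}`, `b y + c z` tops `Q_{y+z}`, `a x + c z` tops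
`R_{x+z}` (the translates of these fibres by the third letter are subsets of the class).  Call such a label triple a TRIANGLE
(`TriTop a b c x y z`: the three pair-fibre normal cones share a direction; NOTES-d1g3 §2 L6 "`T(3) ≤ N_△`", NOTES-t1 D3).  This file types
the chain

  `T ≤ N_△ := #{(x,y,z) : TriTop} ≤ #{(x,y,z) : HexMixed} ≤ N_a + N_b + N_c`

(`totalVert_le_triangleCount`, `triangleCount_le_sum_hexMixed`; the last step is `…HodographFamilies.totalVert_le_flips`' proof): a triangle's
six lattice neighbours are pair-fibre competitors, so they lie strictly below it and `six_turn` makes its hexagon mixed.  `N_△` is CLASS-FREE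
(a statement about the three pair systems only) and sits between `T` and the fold count.  NOTES-t1 D3 observed that at ONE direction there can be
`q^{3/2}` triangles; the TOTAL is `O(q²)` in every census of this seat (`TriangleBound 3` below: annealed maxima `N_△/q² = 2.89, 2.82, 2.64,
2.55, 2.43` for `q = 6, 7, 9, 11, 13`; the Sidon cluster family `2.44 → 2.61 q²`; both extreme regimes `N_△ = T = 2q²` exactly), so the
relaxation is located, not dead: `TriangleBound C → TotalsLawThreeCyclic C` (`totalsLawThreeCyclic_of_triangleBound`).  OPEN, asserted nowhere;
`TotalsLawThree C` remains OPEN; VP ≠ VNP is not touched.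
[folklore: a strict maximiser over a set is a strict maximiser over every subset containing it]
-/

set_option linter.dupNamespace false -- `ValiantsHypothesis.ValiantsHypothesis` (summit = problem) in every name

open scoped BigOperators Pointwise

namespace Summit.ValiantsHypothesis.ValiantsHypothesis.Theorems.NewtonUnitEquationsDissociatedUniform

namespace TotalsLaw

open Literature.Computability.AlgebraicComplexity.KPTT.PlanarMinkowski Matrix

section Triangles

variable {q : ℕ} [NeZero q]

/-- `(x, y, z)` is a TRIANGLE (pairwise-top triple): some weight `w` exposes `a x + b y` on the fibre `P_{x+y}`, `b y + c z` on `Q_{y+z}`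
and `a x + c z` on `R_{x+z}` simultaneously (the three pair-fibre normal cones meet). -/
def TriTop (a b c : ZMod q → (Fin 2 → ℝ)) (x y z : ZMod q) : Prop :=
  ∃ w : Fin 2 → ℝ, IsStrictTop w (fibreFin a b (x + y)) (a x + b y) ∧ IsStrictTop w (fibreFin b c (y + z)) (b y + c z) ∧
    IsStrictTop w (fibreFin a c (x + z)) (a x + c z)

/-- `N_△`: the number of triangles. -/
noncomputable def triangleCount (a b c : ZMod q → (Fin 2 → ℝ)) : ℕ :=
  ∑ x : ZMod q, ∑ y : ZMod q, ∑ z : ZMod q, indic (TriTop a b c x y z)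

/-- **The located class-free conjecture** `N_△ ≤ C q²` (census of NOTES-t1g7 §3: `C = 3` never violated; `C = 2` FALSE already because
`N_△ ≥ T` and `TotalsLawThree 2` is false at small `q`, and the cluster family reaches `2.6 q²` with `T ≈ q²`).  OPEN; asserted nowhere. -/
@[conjecture] def TriangleBound (C : ℕ) : Prop :=
  ∀ (q : ℕ) [NeZero q] (a b c : ZMod q → (Fin 2 → ℝ)), triangleCount a b c ≤ C * q ^ 2

variable (a b c : ZMod q → (Fin 2 → ℝ))

/-- Points of a pair fibre. [folklore] -/
theorem mem_fibreFin_of_sum_eq {f g : ZMod q → (Fin 2 → ℝ)} {r x' y' : ZMod q} (h : x' + y' = r) :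
    f x' + g y' ∈ fibreFin f g r := by
  classical
  unfold fibreFin
  exact Finset.mem_image.2 ⟨x', Finset.mem_univ _, by rw [show r - x' = y' by rw [← h]; ring]⟩

/-- **A class-hull vertex is a triangle.**  If `a x + b y + c (s-x-y)` is a vertex of `conv(class s)` then `(x, y, s-x-y)` is pairwise-top
(the exposing weight of the class vertex exposes each pair point on its fibre, whose translate lies in the class). [folklore] -/
theorem triTop_of_mem_extremePoints {s x y : ZMod q}
    (h : a x + b y + c (s - x - y) ∈ (convexHull ℝ (classPts a b c s)).extremePoints ℝ) : TriTop a b c x y (s - x - y) := by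
  classical
  set z := s - x - y with hz
  rw [← coe_classFin] at h
  obtain ⟨w, hw⟩ := exists_isStrictTop_of_mem_extremePoints h
  have hcls : ∀ {x' y' z' : ZMod q}, x' + y' + z' = s → a x' + b y' + c z' ∈ classFin a b c s := fun h => mem_classFin_of_sum_eq h
  refine ⟨w, ⟨mem_fibreFin_of_sum_eq rfl, fun p hp hne => ?_⟩, ⟨mem_fibreFin_of_sum_eq rfl, fun p hp hne => ?_⟩,
    ⟨mem_fibreFin_of_sum_eq rfl, fun p hp hne => ?_⟩⟩
  · -- `P`-fibre: `p = a x' + b (x + y - x')`, competitor `p + c z`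
    obtain ⟨x', -, rfl⟩ := Finset.mem_image.1 hp
    have hmem : a x' + b (x + y - x') + c z ∈ classFin a b c s := hcls (by rw [hz]; ring)
    have hne' : a x' + b (x + y - x') + c z ≠ a x + b y + c z := fun e => hne (add_right_cancel e)
    have := hw.lt hmem hne'
    simp only [dotProduct_add] at this ⊢
    linarith
  · -- `Q`-fibre: `p = b y' + c (y + z - y')`, competitor `a x + p`
    obtain ⟨y', -, rfl⟩ := Finset.mem_image.1 hp
    have hmem : a x + b y' + c (y + z - y') ∈ classFin a b c s := hcls (by rw [hz]; ring)
    have hne' : a x + b y' + c (y + z - y') ≠ a x + b y + c z := fun e => hne (by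
      have := congrArg (fun v => v - a x) e; simp only [add_sub_cancel_left, add_assoc] at this; simpa [add_assoc] using this)
    have := hw.lt hmem hne'
    simp only [dotProduct_add] at this ⊢
    linarith
  · -- `R`-fibre: `p = a x' + c (x + z - x')`, competitor `p + b y` (reordered)
    obtain ⟨x', -, rfl⟩ := Finset.mem_image.1 hp
    have hmem : a x' + b y + c (x + z - x') ∈ classFin a b c s := hcls (by rw [hz]; ring)
    have hne' : a x' + b y + c (x + z - x') ≠ a x + b y + c z := fun e => hne (by
      have e2 : a x' + c (x + z - x') + b y = a x + c z + b y := by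
        rw [show a x' + c (x + z - x') + b y = a x' + b y + c (x + z - x') by abel, e]; abel
      exact add_right_cancel e2)
    have := hw.lt hmem hne'
    simp only [dotProduct_add] at this ⊢
    linarith

/-- **`T ≤ N_△`.** [folklore] -/
theorem totalVert_le_triangleCount : totalVert a b c ≤ triangleCount a b c := by
  classical
  have hcls : ∀ s : ZMod q, classVert a b c s ≤ ∑ x : ZMod q, ∑ y : ZMod q, indic (TriTop a b c x y (s - x - y)) := by
    intro s
    unfold classVert
    set E := (convexHull ℝ (classPts a b c s)).extremePoints ℝ with hE
    set φ : ZMod q × ZMod q → (Fin 2 → ℝ) := fun xy => a xy.1 + b xy.2 + c (s - xy.1 - xy.2) with hφ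
    set M : Finset (ZMod q × ZMod q) := Finset.univ.filter fun xy => TriTop a b c xy.1 xy.2 (s - xy.1 - xy.2) with hM
    have hsub : E ⊆ φ '' (M : Set (ZMod q × ZMod q)) := by
      intro p hp
      have hp' : p ∈ classPts a b c s := extremePoints_convexHull_subset hp
      obtain ⟨xy, rfl⟩ := hp'
      refine ⟨xy, ?_, rfl⟩
      rw [Finset.mem_coe, hM, Finset.mem_filter]
      exact ⟨Finset.mem_univ _, triTop_of_mem_extremePoints a b c hp⟩
    have hfin : (φ '' (M : Set (ZMod q × ZMod q))).Finite := M.finite_toSet.image φ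
    calc E.ncard ≤ (φ '' (M : Set (ZMod q × ZMod q))).ncard := Set.ncard_le_ncard hsub hfin
      _ ≤ (M : Set (ZMod q × ZMod q)).ncard := Set.ncard_image_le M.finite_toSet
      _ = M.card := Set.ncard_coe_finset M
      _ = ∑ xy : ZMod q × ZMod q, indic (TriTop a b c xy.1 xy.2 (s - xy.1 - xy.2)) := by rw [hM, Finset.card_filter]; rfl
      _ = ∑ x : ZMod q, ∑ y : ZMod q, indic (TriTop a b c x y (s - x - y)) := Fintype.sum_prod_type _
  unfold totalVert triangleCount
  calc ∑ s, classVert a b c s ≤ ∑ s : ZMod q, ∑ x : ZMod q, ∑ y : ZMod q, indic (TriTop a b c x y (s - x - y)) :=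
        Finset.sum_le_sum fun s _ => hcls s
    _ = ∑ x : ZMod q, ∑ s : ZMod q, ∑ y : ZMod q, indic (TriTop a b c x y (s - x - y)) := Finset.sum_comm
    _ = ∑ x : ZMod q, ∑ y : ZMod q, ∑ s : ZMod q, indic (TriTop a b c x y (s - x - y)) :=
        Finset.sum_congr rfl fun x _ => Finset.sum_comm
    _ = ∑ x : ZMod q, ∑ y : ZMod q, ∑ z : ZMod q, indic (TriTop a b c x y z) :=
        Finset.sum_congr rfl fun x _ => Finset.sum_congr rfl fun y _ => sum_sub_sub_eq (fun z => indic (TriTop a b c x y z)) x y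

/-- From a strict top `v` of `F`, a point `p ∈ F` and a vector `n = p - v` with `det(n, d) ≠ 0`: `⟨w, n⟩ < 0`. [folklore] -/
theorem dotProduct_neg_of_isStrictTop_of_cross2 {w v p n d : Fin 2 → ℝ} {F : Finset (Fin 2 → ℝ)} (h : IsStrictTop w F v)
    (hp : p ∈ F) (he : n = p - v) (ho : cross2 n d ≠ 0) : w ⬝ᵥ n < 0 := by
  subst he
  refine dotProduct_sub_neg_of_isStrictTop h hp ?_
  rintro rfl
  rw [sub_self] at ho
  exact ho (by unfold cross2; simp)

/-- **A triangle has a mixed hexagon**: its six lattice neighbours are pair-fibre competitors (two per system), hence strictly below it at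
the common weight, and `six_turn` applies. [folklore] -/
theorem hexMixed_of_triTop {x y z : ZMod q} (h : TriTop a b c x y z) : HexMixed a b c x y z := by
  obtain ⟨w, hP, hQ, hR⟩ := h
  -- the six pair competitors
  have m₁ : a (x + 1) + c (z - 1) ∈ fibreFin a c (x + z) := mem_fibreFin_of_sum_eq (by ring)
  have m₂ : b (y + 1) + c (z - 1) ∈ fibreFin b c (y + z) := mem_fibreFin_of_sum_eq (by ring)
  have m₃ : a (x - 1) + b (y + 1) ∈ fibreFin a b (x + y) := mem_fibreFin_of_sum_eq (by ring)
  have m₄ : a (x - 1) + c (z + 1) ∈ fibreFin a c (x + z) := mem_fibreFin_of_sum_eq (by ring)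
  have m₅ : b (y - 1) + c (z + 1) ∈ fibreFin b c (y + z) := mem_fibreFin_of_sum_eq (by ring)
  have m₆ : a (x + 1) + b (y - 1) ∈ fibreFin a b (x + y) := mem_fibreFin_of_sum_eq (by ring)
  -- the neighbour differences are the pair differences
  have e₁ : a (x + 1) + b y + c (z - 1) - (a x + b y + c z) = a (x + 1) + c (z - 1) - (a x + c z) := by abel
  have e₂ : a x + b (y + 1) + c (z - 1) - (a x + b y + c z) = b (y + 1) + c (z - 1) - (b y + c z) := by abel
  have e₃ : a (x - 1) + b (y + 1) + c z - (a x + b y + c z) = a (x - 1) + b (y + 1) - (a x + b y) := by abel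
  have e₄ : a (x - 1) + b y + c (z + 1) - (a x + b y + c z) = a (x - 1) + c (z + 1) - (a x + c z) := by abel
  have e₅ : a x + b (y - 1) + c (z + 1) - (a x + b y + c z) = b (y - 1) + c (z + 1) - (b y + c z) := by abel
  have e₆ : a (x + 1) + b (y - 1) + c z - (a x + b y + c z) = a (x + 1) + b (y - 1) - (a x + b y) := by abel
  constructor
  · rintro ⟨o₁, o₂, o₃, o₄, o₅, o₆⟩
    rw [← cross2_hexagon₁ a b c x y z] at o₁
    rw [← cross2_hexagon₂ a b c x y z] at o₂
    rw [← cross2_hexagon₃ a b c x y z] at o₃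
    rw [← cross2_hexagon₄ a b c x y z] at o₄
    rw [← cross2_hexagon₅ a b c x y z] at o₅
    rw [← cross2_hexagon₆ a b c x y z] at o₆
    exact six_turn o₁ o₂ o₃ o₄ o₅ o₆
      (dotProduct_neg_of_isStrictTop_of_cross2 hR m₁ e₁ o₁.ne') (dotProduct_neg_of_isStrictTop_of_cross2 hQ m₂ e₂ o₂.ne')
      (dotProduct_neg_of_isStrictTop_of_cross2 hP m₃ e₃ o₃.ne') (dotProduct_neg_of_isStrictTop_of_cross2 hR m₄ e₄ o₄.ne')
      (dotProduct_neg_of_isStrictTop_of_cross2 hQ m₅ e₅ o₅.ne') (dotProduct_neg_of_isStrictTop_of_cross2 hP m₆ e₆ o₆.ne')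
  · rintro ⟨o₁, o₂, o₃, o₄, o₅, o₆⟩
    rw [← cross2_hexagon₁ a b c x y z] at o₁
    rw [← cross2_hexagon₂ a b c x y z] at o₂
    rw [← cross2_hexagon₃ a b c x y z] at o₃
    rw [← cross2_hexagon₄ a b c x y z] at o₄
    rw [← cross2_hexagon₅ a b c x y z] at o₅
    rw [← cross2_hexagon₆ a b c x y z] at o₆
    have r₁ := (cross2_swap _ _).symm ▸ neg_pos.2 o₁
    have r₂ := (cross2_swap _ _).symm ▸ neg_pos.2 o₂
    have r₃ := (cross2_swap _ _).symm ▸ neg_pos.2 o₃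
    have r₄ := (cross2_swap _ _).symm ▸ neg_pos.2 o₄
    have r₅ := (cross2_swap _ _).symm ▸ neg_pos.2 o₅
    have r₆ := (cross2_swap _ _).symm ▸ neg_pos.2 o₆
    exact six_turn r₆ r₅ r₄ r₃ r₂ r₁
      (dotProduct_neg_of_isStrictTop_of_cross2 hR m₁ e₁ o₁.ne) (dotProduct_neg_of_isStrictTop_of_cross2 hP m₆ e₆ o₆.ne)
      (dotProduct_neg_of_isStrictTop_of_cross2 hQ m₅ e₅ o₅.ne) (dotProduct_neg_of_isStrictTop_of_cross2 hR m₄ e₄ o₄.ne)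
      (dotProduct_neg_of_isStrictTop_of_cross2 hP m₃ e₃ o₃.ne) (dotProduct_neg_of_isStrictTop_of_cross2 hQ m₂ e₂ o₂.ne)

/-- **`N_△ ≤ #`mixed hexagons** (so `T ≤ N_△ ≤ #mixed ≤ N_a + N_b + N_c`). [folklore] -/
theorem triangleCount_le_sum_hexMixed :
    triangleCount a b c ≤ ∑ x : ZMod q, ∑ y : ZMod q, ∑ z : ZMod q, indic (HexMixed a b c x y z) := by
  unfold triangleCount
  exact Finset.sum_le_sum fun x _ => Finset.sum_le_sum fun y _ => Finset.sum_le_sum fun z _ =>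
    indic_mono (hexMixed_of_triTop a b c)

end Triangles

/-- **The triangle bound implies the (cyclic) `n = 3` totals law with the same constant.** -/
theorem totalsLawThreeCyclic_of_triangleBound (C : ℕ) (h : TriangleBound C) : TotalsLawThreeCyclic C := by
  intro q _ a b c
  exact (totalVert_le_triangleCount a b c).trans (h q a b c)

end TotalsLaw

end Summit.ValiantsHypothesis.ValiantsHypothesis.Theorems.NewtonUnitEquationsDissociatedUniform
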